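import Summits.HodgeConjecture.HodgeConjecture.Theorems.NoetherLefschetzOneUpK3TypeNetsOddPrimeSquares
import Literature.AlgebraicGeometry.Motives.HodgeStructureK3TranscendentalEndomorphisms

/-!
# Squares of surfaces — a self-map of a `p_g = 1` surface on the transcendental part of `H²_B(S)`
# (descent of Hodge endomorphisms, `σ^*(T) ⊆ T`, powers, `(N¹H²)^⊥ = Θ(T_ℂ)`)

Definition-free engine lemmas for the KERNEL rung «PG1-CM-AUT» (`Theorems/PgOneCyclotomicSquares`:
chapter «SQ-END» of cell hodge-nonav, planner p1 g29, memo `ROUTE-P1AB` §A8, Sketch sha16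
88d3404fc35a91e8, referee PASS g44; ask A34-a). `S` a smooth projective complex surface, `H²_B(S)` the
weight-two `ℚ`-Hodge structure on `H²(S(ℂ); ℚ)` of its real Hodge model, `T ⊆ H²_B(S)` a transcendental
part (`IsTranscendentalPart`), `Θ : ℂ ⊗ H²(S(ℂ); ℚ) ⥲ H²(S(ℂ); ℂ)`:

* `exists_endAlg_of_hodgeEndomorphism` — a `ℂ`-linear endomorphism of `H²(S(ℂ); ℂ)` preserving rational
  classes and Hodge types is `Θ (g ⊗ ℂ) Θ⁻¹` with `g ∈ End_Hdg(H²_B(S))`;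
* `endAlg_apply_mem`, `map_mem_transcendentalPart` — `End_Hdg(H²_B(S))` and pull-backs `σ^*` preserve `T`;
* `coe_pow_apply_eq_map_pow`, `map_pow_ofRatClassBaseChange_subtype` — if `a ∈ End_Hdg(T)` acts as `τ^*`,
  then `a^k` acts as `(τ^k)^*` (powers in the monoid `End S`), also after `Θ ∘ (ι_T ⊗ ℂ)`;
* `map_pow_eq_pow_smul` — `τ^*ω = ζω ⇒ (τ^k)^*ω = ζ^k ω`;
* `cup_eq_zero_of_twoZero`, `exists_baseChange_eq_of_orthogonal` — `H^{2,0} ⊥ N¹H²` and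
  `(N¹H²)^⊥ = Θ(T_ℂ)`.

Prover seat hodge-nonav-19652-p1 g4 (`--supports stmt-HodgeConjecture-19652`, helper). No named fact,
no definition, no sorry.

References: Voisin, *Hodge Theory I* §7.1.1, §7.3.1–7.3.2; Huybrechts, *Lectures on K3 surfaces* (2016)
Ch. 3 Lemma 3.1, §3.3; Hatcher, *Algebraic Topology* §3.1.
-/

set_option linter.dupNamespace false

noncomputable section

namespace Summit.HodgeConjecture.HodgeConjecture.Theorems.PgOneCyclotomicSquares

open scoped TensorProduct
open CategoryTheory MonoidalCategory
open Literature.AlgebraicGeometry Literature.AlgebraicGeometry.Motives Literature.AlgebraicGeometry.HodgeTheory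
open Literature.AlgebraicTopology.SingularHomology
open Literature.AlgebraicGeometry.Motives.HodgeStructure Literature.AlgebraicGeometry.Surfaces
open Summit.HodgeConjecture.HodgeConjecture.Theorems.OddPrimeSquares

variable {S : SchemeOver ℂ}

/-- `H²_B(S)`: the weight-two `ℚ`-Hodge structure on `H²(S(ℂ); ℚ)` of the real Hodge model of `S` (tree notation). -/
local notation3 "H²[" hS "]" =>
  bettiTwoHodgeStructure hS (BettiUniverse.realHodgeModel exists_isReal_hodgeModel_holds hS)
    (BettiUniverse.realHodgeModel_isHodgeSymmetric exists_isReal_hodgeModel_holds hS)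

/-- `T(S)_ℚ = Hdg¹^⊥ ⊆ H²(S(ℂ); ℚ)` (tree notation). -/
local notation3 "T[" hS "]" =>
  transcendentalLatticeBetti hS (BettiUniverse.realHodgeModel exists_isReal_hodgeModel_holds hS)
    (BettiUniverse.realHodgeModel_isHodgeSymmetric exists_isReal_hodgeModel_holds hS)

/-- `Θ : ℂ ⊗_ℚ H²(S(ℂ); ℚ) → H²(S(ℂ); ℂ)` (tree notation). -/
local notation3 "Θ[" S "]" => ofRatClassBaseChange (Motives.ComplexPoints S) (2 * 1)

/-- `τ^[k]`: the `k`-th power of a self-map `τ : S ⟶ S`, taken in the monoid `End S`. Local notation only. -/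
local notation3 τ "^[" k "]" => ((CategoryTheory.End.of τ ^ (k : ℕ) : CategoryTheory.End _) : _ ⟶ _)

/-! ### Descent of Hodge endomorphisms and pull-backs to `H²(S(ℂ); ℚ)` -/

/-- **Descent with Hodge types**: a `ℂ`-linear endomorphism of `H²(S(ℂ); ℂ)` preserving rational classes
and Hodge types is `Θ ∘ (g ⊗ ℂ) ∘ Θ⁻¹` for a Hodge endomorphism `g ∈ End_Hdg(H²_B(S))` (the tree's
`exists_ratEnd_of_isRationalClass` plus the filtration bookkeeping of `hodgeEndomorphisms_scalar`).
[cite: VoisinHodgeI2002, §7.1.1 and Prop. 7.5] -/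
theorem exists_endAlg_of_hodgeEndomorphism (hS : IsSmoothProjective 2 S)
    (f : complexBetti S (2 * 1) →ₗ[ℂ] complexBetti S (2 * 1))
    (hf₁ : ∀ y, IsRationalClass y → IsRationalClass (f y))
    (hf₂ : ∀ (i j : ℕ) y, IsOfHodgeType 2 S (2 * 1) i j y → IsOfHodgeType 2 S (2 * 1) i j (f y)) :
    ∃ g : (H²[hS]).endAlg,
      (∀ v, ofRatClass (Motives.ComplexPoints S) (2 * 1)
          ((g : Module.End ℚ (bettiCohomology S (2 * 1))) v) =
        f (ofRatClass (Motives.ComplexPoints S) (2 * 1) v)) ∧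
      ∀ x, f (Θ[S] x) = Θ[S] ((g : Module.End ℚ (bettiCohomology S (2 * 1))).baseChange ℂ x) := by
  haveI : Module.Finite ℚ (bettiCohomology S (2 * 1)) := BettiUniverse.finite hS (2 * 1)
  set M := BettiUniverse.realHodgeModel exists_isReal_hodgeModel_holds hS with hMdef
  have hI := hodgePQ_independent_of_hodgeModel_holds
  obtain ⟨g, hgofRat, hg⟩ := exists_ratEnd_of_isRationalClass f hf₁
  have hgF : ∀ p : ℤ, ((H²[hS]).F p).map (g.baseChange ℂ) ≤ (H²[hS]).F p := by
    intro p
    rintro _ ⟨x, hx, rfl⟩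
    change x ∈ (BettiUniverse.hodge exists_isReal_hodgeModel_holds hS (2 * 1)).F p at hx
    change g.baseChange ℂ x ∈ (BettiUniverse.hodge exists_isReal_hodgeModel_holds hS (2 * 1)).F p
    rw [BettiUniverse.hodge_F, HodgeModel.ratF_eq_iSup] at hx ⊢
    induction hx using Submodule.iSup_induction' with
    | mem pq x hx =>
      by_cases hp' : p ≤ (pq.1.1 : ℤ)
      · rw [iSup_pos hp'] at hx
        refine Submodule.mem_iSup_of_mem pq (Submodule.mem_iSup_of_mem hp' ?_)
        rw [HodgeModel.mem_ratPiece_iff, HodgeModel.complexification_apply] at hx ⊢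
        have h1 : IsOfHodgeType 2 S (2 * 1) pq.1.1 pq.1.2 (Θ[S] x) := ⟨M, hx⟩
        have h2 := hf₂ _ _ _ h1
        rw [hg] at h2
        obtain ⟨B, hB⟩ := h2
        exact hI 2 S hS B M (2 * 1) _ _ _ hB
      · rw [iSup_neg hp', Submodule.mem_bot] at hx
        rw [hx, map_zero]
        exact Submodule.zero_mem _
    | zero => rw [map_zero]; exact Submodule.zero_mem _
    | add x y _ _ hx hy => rw [map_add]; exact Submodule.add_mem _ hx hy
  exact ⟨⟨g, (mem_endAlg_iff _ _).2 hgF⟩, hgofRat, hg⟩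

/-- `Θ` intertwines `σ^*` on `H²(S(ℂ); ℚ)` and on `H²(S(ℂ); ℂ)`. [cite: HatcherAT2002, §3.1 p. 198] -/
theorem map_ofRatClass (σ : S ⟶ S) (v : bettiCohomology S (2 * 1)) :
    complexBetti.map σ (2 * 1) (ofRatClass (Motives.ComplexPoints S) (2 * 1) v) =
      ofRatClass (Motives.ComplexPoints S) (2 * 1) (bettiCohomology.map σ (2 * 1) v) :=
  (Motives.ofRatClass_map (2 * 1) (Motives.AlgPoints.mapContinuous (L := ℂ) σ) v).symm

/-- **Every Hodge endomorphism of `H²_B(S)` preserves a transcendental part** (tree splitting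
`End_Hdg(H²_B) ≃ End_Hdg(Hdg¹) × End_Hdg(T)`). [cite: Huybrechts2016K3, Ch. 3 Lemma 3.1 and §3.3] -/
theorem endAlg_apply_mem (hS : IsSmoothProjective 2 S) (hK3 : (H²[hS]).IsOfK3Type)
    {T : SubHodgeStructure (H²[hS])} (htr : (H²[hS]).IsTranscendentalPart T) (a : (H²[hS]).endAlg)
    {v : bettiCohomology S (2 * 1)} (hv : v ∈ T.toSubmodule) :
    (a : Module.End ℚ (bettiCohomology S (2 * 1))) v ∈ T.toSubmodule := by
  haveI : Module.Finite ℚ (bettiCohomology S (2 * 1)) := BettiUniverse.finite hS (2 * 1)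
  obtain ⟨e, he⟩ := htr.exists_algEquiv_endAlg_pi hK3 (isPolarizable_bettiTwo hS)
  rw [← he a false ⟨v, hv⟩]
  exact SetLike.coe_mem _

/-- **A self-map `σ : S ⟶ S` preserves every transcendental part**: `σ^*(T) ⊆ T` (`σ^*` is a morphism of
Hodge structures, tree `BettiUniverse.pullHodgeHom`). [cite: VoisinHodgeI2002, §7.3.2] -/
theorem map_mem_transcendentalPart (hS : IsSmoothProjective 2 S) (hK3 : (H²[hS]).IsOfK3Type)
    {T : SubHodgeStructure (H²[hS])} (htr : (H²[hS]).IsTranscendentalPart T) (σ : S ⟶ S)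
    {v : bettiCohomology S (2 * 1)} (hv : v ∈ T.toSubmodule) :
    bettiCohomology.map σ (2 * 1) v ∈ T.toSubmodule := by
  have h := endAlg_apply_mem hS hK3 htr
    ⟨(BettiUniverse.pullHodgeHom exists_isReal_hodgeModel_holds hodgePQ_independent_of_hodgeModel_holds hS hS σ
      (2 * 1)).toLinearMap, Hom.toLinearMap_mem_endAlg _⟩ hv
  rwa [Subtype.coe_mk, BettiUniverse.pullHodgeHom_toLinearMap] at h

/-! ### Powers of a self-map on a transcendental part -/

/-- **Powers**: if `a ∈ End_Hdg(T)` acts on `T ⊆ H²(S(ℂ); ℚ)` as `τ^*`, then `a^k` acts as `(τ^k)^*`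
(powers of `τ` in the monoid `End S`; contravariance `(σ ≫ τ)^* = σ^* ∘ τ^*`). -/
theorem coe_pow_apply_eq_map_pow (hS : IsSmoothProjective 2 S) {T : SubHodgeStructure (H²[hS])}
    (τ : S ⟶ S) (a : T.toHodgeStructure.endAlg)
    (ha : ∀ w : T.toSubmodule, (((a : Module.End ℚ T.toSubmodule) w : T.toSubmodule) : bettiCohomology S (2 * 1)) =
      bettiCohomology.map τ (2 * 1) (w : bettiCohomology S (2 * 1)))
    (k : ℕ) (w : T.toSubmodule) :
    ((((a ^ k : T.toHodgeStructure.endAlg) : Module.End ℚ T.toSubmodule) w : T.toSubmodule) :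
        bettiCohomology S (2 * 1)) = bettiCohomology.map (τ^[k]) (2 * 1) (w : bettiCohomology S (2 * 1)) := by
  induction k generalizing w with
  | zero =>
    rw [pow_zero, pow_zero]
    show (w : bettiCohomology S (2 * 1)) = bettiCohomology.map (𝟙 S) (2 * 1) (w : bettiCohomology S (2 * 1))
    rw [bettiCohomology.map_id]
    rfl
  | succ k ih =>
    rw [pow_succ', pow_succ, CategoryTheory.End.mul_def, bettiCohomology.map_comp, MulMemClass.coe_mul,
      Module.End.mul_apply]
    show ((((a : Module.End ℚ T.toSubmodule) (((a ^ k : T.toHodgeStructure.endAlg) :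
        Module.End ℚ T.toSubmodule) w)) : T.toSubmodule) : bettiCohomology S (2 * 1)) =
      bettiCohomology.map τ (2 * 1) (bettiCohomology.map (τ^[k]) (2 * 1) (w : bettiCohomology S (2 * 1)))
    rw [ha, ih]

/-- **`Θ ∘ (ι_T ⊗ ℂ)` intertwines `(τ^k)^*` on `H²(S(ℂ); ℂ)` with `a^k ⊗ ℂ` on `T_ℂ`**, for `a` as above. -/
theorem map_pow_ofRatClassBaseChange_subtype (hS : IsSmoothProjective 2 S) {T : SubHodgeStructure (H²[hS])}
    (τ : S ⟶ S) (a : T.toHodgeStructure.endAlg)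
    (ha : ∀ w : T.toSubmodule, (((a : Module.End ℚ T.toSubmodule) w : T.toSubmodule) : bettiCohomology S (2 * 1)) =
      bettiCohomology.map τ (2 * 1) (w : bettiCohomology S (2 * 1)))
    (k : ℕ) (u : ℂ ⊗[ℚ] T.toSubmodule) :
    complexBetti.map (τ^[k]) (2 * 1) (Θ[S] (T.toSubmodule.subtype.baseChange ℂ u)) =
      Θ[S] (T.toSubmodule.subtype.baseChange ℂ
        (((a ^ k : T.toHodgeStructure.endAlg) : Module.End ℚ T.toSubmodule).baseChange ℂ u)) := by
  induction u using TensorProduct.induction_on with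
  | zero => simp only [map_zero]
  | tmul c w =>
    rw [LinearMap.baseChange_tmul, ofRatClassBaseChange_tmul, map_smul, Submodule.subtype_apply, map_ofRatClass,
      LinearMap.baseChange_tmul, LinearMap.baseChange_tmul, ofRatClassBaseChange_tmul, Submodule.subtype_apply,
      coe_pow_apply_eq_map_pow hS τ a ha]
  | add x y hx hy => rw [map_add, map_add, map_add, hx, hy, map_add, map_add, map_add]

/-- **The eigenvalue of `(σ^k)^*` on an eigenclass**: `σ^*ω = ζω ⇒ (σ^k)^*ω = ζ^k ω`. -/
theorem map_pow_eq_pow_smul (σ : S ⟶ S) {ω : complexBetti S (2 * 1)} {ζ : ℂ}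
    (heig : complexBetti.map σ (2 * 1) ω = ζ • ω) (k : ℕ) :
    complexBetti.map (σ^[k]) (2 * 1) ω = ζ ^ k • ω := by
  induction k with
  | zero =>
    rw [pow_zero, pow_zero, one_smul]
    show complexBetti.map (𝟙 S) (2 * 1) ω = ω
    rw [complexBetti.map_id]
    rfl
  | succ k ih =>
    rw [pow_succ (CategoryTheory.End.of σ) k, CategoryTheory.End.mul_def, complexBetti.map_comp, pow_succ,
      mul_smul]
    show complexBetti.map σ (2 * 1) (complexBetti.map (σ^[k]) (2 * 1) ω) = _
    rw [ih, map_smul, heig]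

/-! ### `(N¹H²)^⊥ = Θ(T_ℂ)` -/

/-- **`H^{2,0}(S) ⊥ N¹H²(S)`**: a `(2,0)`-class cupped with a divisor class (type `(1,1)`) is of type
`(3,1)`, which vanishes on a surface. [cite: VoisinHodgeI2002, §6.1 and Thm. 11.30] -/
theorem cup_eq_zero_of_twoZero (hS : IsSmoothProjective 2 S) {c : complexBetti S (2 * 1)}
    (hc : IsOfHodgeType 2 S (2 * 1) 2 0 c) {d : complexBetti S (2 * 1)} (hd : d ∈ algebraicClasses S 1) :
    cupProduct (rfl : 2 * 1 + 2 * 1 = 2 * 2) c d = 0 :=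
  eq_zero_of_isOfHodgeType_of_lt hS (by norm_num) (by norm_num)
    (BettiUniverse.cupPreservesHodgeType exists_isReal_hodgeModel_holds hodgePQ_independent_of_hodgeModel_holds hS
      (rfl : 2 * 1 + 2 * 1 = 2 * 2) hc (isOfHodgeType_of_mem_algebraicClasses_of_isSmoothProjective hS 1 hd))

/-- **Classes orthogonal to `N¹H²(S)` come from `T(S)_ℂ`**: `(N¹H²)^⊥ = Θ((ι_T ⊗ ℂ)(ℂ ⊗ T))`
(`Θ(Hdg¹_ℂ) = N¹H²`, `(Hdg¹^⊥)_ℂ = (Hdg¹_ℂ)^⊥`). [cite: Huybrechts2016K3, Ch. 3 Lemma 3.1] -/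
theorem exists_baseChange_eq_of_orthogonal (hS : IsSmoothProjective 2 S) {T : SubHodgeStructure (H²[hS])}
    (hT : T.toSubmodule = T[hS]) {y : complexBetti S (2 * 1)}
    (hy : ∀ d ∈ algebraicClasses S 1, cupProduct (rfl : 2 * 1 + 2 * 1 = 2 * 2) y d = 0) :
    ∃ u : ℂ ⊗[ℚ] T.toSubmodule, Θ[S] (T.toSubmodule.subtype.baseChange ℂ u) = y := by
  haveI : Module.Finite ℚ (bettiCohomology S (2 * 1)) := BettiUniverse.finite hS (2 * 1)
  have h4 : 2 * 1 + 2 * 1 = 2 * 2 := rfl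
  obtain ⟨x, rfl⟩ := ofRatClassBaseChange_surjective hS (2 * 1) y
  have hxT : x ∈ T.toSubmodule.baseChange ℂ := by
    rw [hT, transcendentalLatticeBetti, baseChange_orthogonal_eq _ (cupPairingBetti_nondegenerate hS),
      LinearMap.BilinForm.mem_orthogonal_iff]
    intro z hz
    apply cupPairingBetti_baseChange_eq_zero_of_cup hS
    rw [cup_baseChange_eq_zero_iff]
    have hzN : Θ[S] z ∈ algebraicClasses S 1 := by
      rw [← map_hodgeClasses_baseChange_eq_algebraicClasses hS]
      exact ⟨z, hz, rfl⟩
    rw [cupProduct_gradedComm_holds ℂ (Motives.ComplexPoints S) h4 h4, hy _ hzN, smul_zero]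
  obtain ⟨u, rfl⟩ := hxT
  exact ⟨u, rfl⟩

end Summit.HodgeConjecture.HodgeConjecture.Theorems.PgOneCyclotomicSquares

end
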